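import Summits.AtomisticToContinuum.HydrodynamicLimit.Theorems.StiffCollisionalRelaxationAprioriBoundsMesoOccupationInProb
import Summits.AtomisticToContinuum.HydrodynamicLimit.Theorems.StiffCollisionalRelaxationAprioriBoundsMesoPartOneOfOccupation
import HarnessLib

/-!
# Stub `stub_partOne_of_varianceTails` of the line `meso-chebyshev-window` for the crux `AprioriBounds`
(stmt-AtomisticToContinuum-14827; `StiffCollisionalRelaxation.AprioriBounds` = `CollisionIsometryCLT.AprioriBoundsPreShock`)

Lead prover `prover-line-stmt-AtomisticToContinuum-14827-a2-0`, skeleton r1 of the line (registered stub 7).  Component (i) of the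
crux (`PartOneAt`: `∃ λ > 0, C` with `P_N{C < ∫₀ᵗ (N+1)⁻¹∑ᵢ e^{λ|vᵢ(s)|²} ds} → 0`) from

* CONCENTRATION: for every fixed level `K`, `Var_{P_N}(occ_K) → 0`, where `occ_K(z) = ∫₀ᵗ frac_K(Φ_s z) ds` is the
  time-integrated one-particle tail occupation (the conclusion of the open stub `stub_occupationVariance`), and
* SIZE: far tails in the MEAN at all levels, `FarTailAllAt` (`E_N occ_K ≤ t·A·e^{−K/(2Θ)}` eventually, for all `K`; the
  conclusion of the import stub `stub_farTailAll`),

for `0 < σ ≤ 1/2`, nice profiles, `t > 0` and ANY flow family.  It is literally the composition of the two landed registered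
stubs `stub_occupationInProb_of_variance` (Chebyshev at each level: variances + `FarTailAllAt` ⇒ the in-probability occupation
profile `P_N{tA'e^{−K/2Θ} + η < occ_K} → 0`, file `…MesoOccupationInProb.lean`) and `stub_partOne_of_occupation` (the λ-dial:
occupation profile + `FarTailAllAt` ⇒ `PartOneAt`, file `…MesoPartOneOfOccupation.lean`).  No new mathematics here.
-/

noncomputable section

open MeasureTheory ProbabilityTheory Filter Set Topology
open scoped ENNReal

namespace Summit.AtomisticToContinuum.HydrodynamicLimit.Theorems.MesoChebyshevWindow

open Literature.MathematicalPhysics.KineticTheory Literature.Analysis.FluidPDE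
open Summit.AtomisticToContinuum.HydrodynamicLimit.Theorems.AprioriBoundsNegative (PartOneAt PartTwoAt)
open Summit.AtomisticToContinuum.HydrodynamicLimit.Theorems.VisitLedgerUpscattering (Cfg Flow Flows NiceProfiles)
open Summit.AtomisticToContinuum.HydrodynamicLimit.Theorems.FibreDeficitTransfer

/-- **Registered stub 7 of the line `meso-chebyshev-window` (`stub_partOne_of_varianceTails`).**  For `0 < σ ≤ 1/2`, nice
profiles, `t > 0` and any flow family: vanishing variances of the time-integrated tail occupations at every level and far
tails in the mean (`FarTailAllAt`) give component (i) of the crux, `PartOneAt σ a₀ θ₀ u₀ Φ t` — Chebyshev at each level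
(`stub_occupationInProb_of_variance`) followed by the λ-dial (`stub_partOne_of_occupation`). -/
theorem stub_partOne_of_varianceTails :
    ∀ (σ : ℝ) (a₀ θ₀ : T3 → ℝ) (u₀ : T3 → V3)
      (Φ : (N : ℕ) → HardSphereFlow (Torus.geometry (Fin 3)) (hsDiameter σ N) (N + 1)) (t : ℝ),
      0 < σ → σ ≤ 1 / 2 → NiceProfiles a₀ θ₀ u₀ → 0 < t →
      (∀ K : ℝ, Tendsto (fun N : ℕ => variance
          (fun z => (∫⁻ s in Icc 0 t, ENNReal.ofReal (frac K ((Φ N).flow s z))).toReal)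
          (localGibbsLaw σ a₀ u₀ θ₀ N (Φ N))) atTop (𝓝 0)) →
      FarTailAllAt σ a₀ θ₀ u₀ Φ t → PartOneAt σ a₀ θ₀ u₀ Φ t := by
  intro σ a₀ θ₀ u₀ Φ t hσ hσ2 hP ht hVar hFar
  exact stub_partOne_of_occupation σ a₀ θ₀ u₀ Φ t hσ hσ2 hP ht
    (stub_occupationInProb_of_variance σ a₀ θ₀ u₀ Φ t hσ hσ2 hP ht hVar hFar) hFar

end Summit.AtomisticToContinuum.HydrodynamicLimit.Theorems.MesoChebyshevWindow

end
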